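import Summits.QuantumFields.YangMills.Theorems.AntiScreeningCeilingsMonotoneTransfer
import Summits.QuantumFields.YangMills.Theorems.SquareRootCeilingsMirrorDomination
import HarnessLib

/-!
# Route `AntiScreeningCeilings`: the support `MonotoneMirrorTransfer` (stmt-QuantumFields-27236) holds

`ScaleMonotonicity → MaximalSeparationCeiling → SquareRootCeilings.SubOnsetTwoPointCeilings`.  The anchor transfer
`ScaleMonotonicity → MaximalSeparationCeiling → AxisMirrorCeiling` is the landed `AntiScreeningCeilings.monotoneTransfer`
(ym-idea-11 g4, `Theorems/AntiScreeningCeilingsMonotoneTransfer.lean`), which also records the reduction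
`monotoneMirrorTransfer_of_mirrorDomination : SquareRootCeilings.MirrorDomination → MonotoneMirrorTransfer`; the
reflection-positivity step `MirrorDomination` (stmt-QuantumFields-26792) is now PROVED
(`Theorems/SquareRootCeilingsMirrorDomination.lean`, `MirrorDomination.squareRootCeilings_mirrorDomination_proof`),
so the item closes by modus ponens.  Width seat ym-line-sfw-p2-w2 g21 (free hands).  No summit / leaf / NT statement is
proved; the cruxes `ScaleMonotonicity`, `MaximalSeparationCeiling` of the route remain open.
-/

set_option autoImplicit false

namespace Summit.QuantumFields.YangMills.Theorems

/-- **Item stmt-QuantumFields-27236 `AntiScreeningCeilings.MonotoneMirrorTransfer` holds**: the landed anchor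
transfer composed with the proved RP mirror domination. [folklore] -/
theorem antiScreeningCeilings_monotoneMirrorTransfer_proof :
    Summit.QuantumFields.YangMills.Theses.AntiScreeningCeilings.MonotoneMirrorTransfer :=
  Summit.QuantumFields.YangMills.Theses.AntiScreeningCeilings.monotoneMirrorTransfer_of_mirrorDomination
    MirrorDomination.squareRootCeilings_mirrorDomination_proof

end Summit.QuantumFields.YangMills.Theorems
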